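import Summits.QuantumFields.YangMills.Theorems.EguchiKawaiDirectionLadderPlaquetteLoopEquation
import Literature.Barriers.QuantumFields.EguchiKawaiBreakdownStrongCoupling
import Literature.MathematicalPhysics.QuantumFieldTheory.TiltedExponentMorseBounds
import HarnessLib

/-!
# The reduced plaquette of the Eguchi–Kawai model is `O(b)` at strong coupling, uniformly in `N`

HONEST FRAMING. Glue for LINE 8 (`route-QuantumFields-EguchiKawaiDirectionLadder`, barrier-ledger line
onto `Literature.Barriers.QuantumFields.EguchiKawaiBreakdown`); a consequence of the finite-`N` loop
equation of the reduced plaquette (`ek_plaquette_loopEquation`) and of the strong-coupling bound on the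
open lines (`Literature.Barriers.QuantumFields.ekOrderParameter_le_of_strongCoupling`, LEAD g26):

* `linkLipschitz_ekPlaq`, `Gam_ekPlaq_le` : the reduced plaquette `Re tr(V_νᴴ V_μᴴ V_ν V_μ)` is
  `2√N`-Lipschitz in each of its two links, so `Γ(P,P) ≤ 8N` on `SU(N)^d`;
* `linkLipschitz_ekPot`, `Gam_ekPot_le` : the potential `-N² b S_R` is `2dN√N|b|`-Lipschitz in every
  link, so `Γ(S,S) ≤ 4d³N³b²`;
* `abs_Gam_ekPot_ekPlaq_le` : hence the interaction term of the loop equation is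
  `|Γ(-N²bS_R, Re tr P)| ≤ 6 d² N² |b|` pointwise (Cauchy–Schwarz for `Γ`);
* `ek_plaquette_abs_le` : for `N ≥ 2`, `μ ≠ ν` and `8|b|(d-1) < 1`,
  `|⟨(1/N) Re tr(V_νᴴ V_μᴴ V_ν V_μ)⟩_{SU(N) EK}| ≤ 4/(N²(1 - 8|b|(d-1))) + (3/2) d² |b|` —
  the single-site plaquette is `O(b) + O(1/N²)` at strong coupling, UNIFORMLY IN `N` (the open-line
  terms of the loop equation are `O(1/N²)` by the unbroken centre symmetry, the interaction term is
  `O(b)`), the `N`-uniform counterpart of the first step of the strong-coupling expansion of the reduced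
  model (Makeenko §14.3, «the equivalence (14.44) holds at least for large enough values of g²N»).

Nothing here concerns the Yang–Mills mass gap / the summit Statement `YangMills`.

References: Y. Makeenko, *Methods of Contemporary Gauge Theory* (2023) §14.3 (14.44), Problem 14.2;
H. Shen, R. Zhu, X. Zhu, CMP 400 (2023) 805, Cor. 1.8-type large-`N` bounds (lattice analogue).
-/

noncomputable section

open scoped Matrix ComplexConjugate BigOperators Matrix.Norms.Frobenius ContDiff Topology
open Matrix Complex Finset MeasureTheory Filter
open Summit.Ventures.YMGap.LatticeBakryEmery
open Summit.Ventures.YMGap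
open Literature.MathematicalPhysics.QuantumFieldTheory (frobNorm frobNorm_nonneg frobNorm_add_le
  frobNorm_conjTranspose frobNorm_unitary_mul frobNorm_mul_unitary suFrobDist)
open Literature.Barriers.QuantumFields (EKConfigSU ekHaarSU inclSU ekWeight ekAction ekPlaqTrace openLine
  coe_inclSU_apply ekExpectationSU ekOrderParameterSU ekOrderParameterSU_eq ekPartitionSU_pos
  ekOrderParameter_le_of_strongCoupling)
open Literature.MathematicalPhysics.QuantumFieldTheory.OneLinkLaplace (conjTranspose_mem_unitaryGroup)

namespace Summit.QuantumFields.YangMills.Theorems.EguchiKawaiDirectionLadder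

variable {d N : ℕ}

/-! ## Lipschitz constants of the reduced plaquette -/

/-- Moving the SECOND letter of the plaquette word `Wᴴ Aᴴ W A` (unitary `W, A, B`):
`|Re tr(Wᴴ Aᴴ W A) - Re tr(Wᴴ Bᴴ W B)| ≤ 2√N ‖A - B‖_F`. -/
theorem abs_re_trace_plaq_sub_le_snd {W A B : Matrix (Fin N) (Fin N) ℂ}
    (hW : W ∈ Matrix.unitaryGroup (Fin N) ℂ) (hA : A ∈ Matrix.unitaryGroup (Fin N) ℂ)
    (hB : B ∈ Matrix.unitaryGroup (Fin N) ℂ) :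
    |(Wᴴ * Aᴴ * W * A).trace.re - (Wᴴ * Bᴴ * W * B).trace.re| ≤ 2 * Real.sqrt N * frobNorm (A - B) := by
  have h0 : |(Wᴴ * Aᴴ * W * A).trace.re - (Wᴴ * Bᴴ * W * B).trace.re| ≤
      Real.sqrt N * frobNorm (Wᴴ * Aᴴ * W * A - Wᴴ * Bᴴ * W * B) := by
    rw [← Complex.sub_re, ← Matrix.trace_sub]
    exact (Complex.abs_re_le_norm _).trans (norm_trace_le_sqrt_mul_frobNorm _)
  refine h0.trans ?_
  have hsplit : Wᴴ * Aᴴ * W * A - Wᴴ * Bᴴ * W * B =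
      Wᴴ * ((Aᴴ - Bᴴ) * (W * A)) + Wᴴ * (Bᴴ * (W * (A - B))) := by
    simp only [Matrix.mul_sub, Matrix.sub_mul, Matrix.mul_assoc]
    abel
  have h1 : frobNorm (Wᴴ * ((Aᴴ - Bᴴ) * (W * A))) = frobNorm (A - B) := by
    rw [frobNorm_unitary_mul (conjTranspose_mem_unitaryGroup hW), ← Matrix.mul_assoc,
      frobNorm_mul_unitary _ hA, frobNorm_mul_unitary _ hW, ← Matrix.conjTranspose_sub, frobNorm_conjTranspose]
  have h2 : frobNorm (Wᴴ * (Bᴴ * (W * (A - B)))) = frobNorm (A - B) := by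
    rw [frobNorm_unitary_mul (conjTranspose_mem_unitaryGroup hW),
      frobNorm_unitary_mul (conjTranspose_mem_unitaryGroup hB), frobNorm_unitary_mul hW]
  rw [hsplit]
  calc Real.sqrt N * frobNorm (Wᴴ * ((Aᴴ - Bᴴ) * (W * A)) + Wᴴ * (Bᴴ * (W * (A - B))))
      ≤ Real.sqrt N * (frobNorm (Wᴴ * ((Aᴴ - Bᴴ) * (W * A))) + frobNorm (Wᴴ * (Bᴴ * (W * (A - B))))) :=
        mul_le_mul_of_nonneg_left (frobNorm_add_le _ _) (Real.sqrt_nonneg _)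
    _ = 2 * Real.sqrt N * frobNorm (A - B) := by rw [h1, h2]; ring

/-- Moving the FIRST letter of the plaquette word `Aᴴ Uᴴ A U` (unitary `U, A, B`):
`|Re tr(Aᴴ Uᴴ A U) - Re tr(Bᴴ Uᴴ B U)| ≤ 2√N ‖A - B‖_F`. -/
theorem abs_re_trace_plaq_sub_le_fst {U A B : Matrix (Fin N) (Fin N) ℂ}
    (hU : U ∈ Matrix.unitaryGroup (Fin N) ℂ) (hA : A ∈ Matrix.unitaryGroup (Fin N) ℂ)
    (hB : B ∈ Matrix.unitaryGroup (Fin N) ℂ) :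
    |(Aᴴ * Uᴴ * A * U).trace.re - (Bᴴ * Uᴴ * B * U).trace.re| ≤ 2 * Real.sqrt N * frobNorm (A - B) := by
  have h0 : |(Aᴴ * Uᴴ * A * U).trace.re - (Bᴴ * Uᴴ * B * U).trace.re| ≤
      Real.sqrt N * frobNorm (Aᴴ * Uᴴ * A * U - Bᴴ * Uᴴ * B * U) := by
    rw [← Complex.sub_re, ← Matrix.trace_sub]
    exact (Complex.abs_re_le_norm _).trans (norm_trace_le_sqrt_mul_frobNorm _)
  refine h0.trans ?_
  have hsplit : Aᴴ * Uᴴ * A * U - Bᴴ * Uᴴ * B * U =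
      (Aᴴ - Bᴴ) * (Uᴴ * (A * U)) + Bᴴ * (Uᴴ * ((A - B) * U)) := by
    simp only [Matrix.mul_sub, Matrix.sub_mul, Matrix.mul_assoc]
    abel
  have h1 : frobNorm ((Aᴴ - Bᴴ) * (Uᴴ * (A * U))) = frobNorm (A - B) := by
    rw [← Matrix.mul_assoc, ← Matrix.mul_assoc, frobNorm_mul_unitary _ hU, frobNorm_mul_unitary _ hA,
      frobNorm_mul_unitary _ (conjTranspose_mem_unitaryGroup hU), ← Matrix.conjTranspose_sub,
      frobNorm_conjTranspose]
  have h2 : frobNorm (Bᴴ * (Uᴴ * ((A - B) * U))) = frobNorm (A - B) := by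
    rw [frobNorm_unitary_mul (conjTranspose_mem_unitaryGroup hB),
      frobNorm_unitary_mul (conjTranspose_mem_unitaryGroup hU), frobNorm_mul_unitary _ hU]
  rw [hsplit]
  calc Real.sqrt N * frobNorm ((Aᴴ - Bᴴ) * (Uᴴ * (A * U)) + Bᴴ * (Uᴴ * ((A - B) * U)))
      ≤ Real.sqrt N * (frobNorm ((Aᴴ - Bᴴ) * (Uᴴ * (A * U))) + frobNorm (Bᴴ * (Uᴴ * ((A - B) * U)))) :=
        mul_le_mul_of_nonneg_left (frobNorm_add_le _ _) (Real.sqrt_nonneg _)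
    _ = 2 * Real.sqrt N * frobNorm (A - B) := by rw [h1, h2]; ring

/-- **The reduced plaquette is `2√N`-Lipschitz in each of its two links** (and constant in the
others): each link occurs twice, and unitary factors do not change Frobenius norms. -/
theorem linkLipschitz_ekPlaq {μ ν : Fin d} (hμν : μ ≠ ν) :
    LinkLipschitz (ekPlaq (N := N) μ ν)
      (fun e => (if e = μ then 2 * Real.sqrt N else 0) + (if e = ν then 2 * Real.sqrt N else 0)) := by
  intro e g h hgh
  by_cases heμ : e = μ
  · -- the link `μ` moves, `ν` is frozen
    have hν : g ν = h ν := hgh ν (fun hνe => hμν (hνe.trans heμ).symm)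
    rw [heμ]
    show _ ≤ ((if μ = μ then 2 * Real.sqrt N else 0) + (if μ = ν then 2 * Real.sqrt N else 0)) * _
    rw [if_pos rfl, if_neg hμν, add_zero]
    simp only [ekPlaq, emb_apply, suFrobDist, hν]
    exact abs_re_trace_plaq_sub_le_snd (emb_mem_unitaryGroup h ν) (emb_mem_unitaryGroup g μ)
      (emb_mem_unitaryGroup h μ)
  by_cases heν : e = ν
  · -- the link `ν` moves, `μ` is frozen
    have hμ : g μ = h μ := hgh μ (fun hμe => heμ (hμe.symm))
    rw [heν]
    show _ ≤ ((if ν = μ then 2 * Real.sqrt N else 0) + (if ν = ν then 2 * Real.sqrt N else 0)) * _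
    rw [if_neg (fun h' : ν = μ => hμν h'.symm), if_pos rfl, zero_add]
    simp only [ekPlaq, emb_apply, suFrobDist, hμ]
    exact abs_re_trace_plaq_sub_le_fst (emb_mem_unitaryGroup h μ) (emb_mem_unitaryGroup g ν)
      (emb_mem_unitaryGroup h ν)
  · -- neither: the plaquette does not move
    have hμ : g μ = h μ := hgh μ (fun hμe => heμ hμe.symm)
    have hν : g ν = h ν := hgh ν (fun hνe => heν hνe.symm)
    show _ ≤ ((if e = μ then 2 * Real.sqrt N else 0) + (if e = ν then 2 * Real.sqrt N else 0)) * _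
    rw [if_neg heμ, if_neg heν, add_zero, zero_mul]
    simp only [ekPlaq, emb_apply, hμ, hν, sub_self, abs_zero, le_refl]

/-- `Σ_e L_e² = 8N` for the Lipschitz profile of the reduced plaquette. -/
theorem sum_sq_lipPlaq {μ ν : Fin d} (hμν : μ ≠ ν) :
    ∑ e : Fin d, ((if e = μ then 2 * Real.sqrt N else 0) + (if e = ν then 2 * Real.sqrt N else (0 : ℝ))) ^ 2 =
      8 * N := by
  rw [Finset.sum_eq_add μ ν hμν]
  · rw [if_pos rfl, if_neg hμν, if_neg (fun h' : ν = μ => hμν h'.symm), if_pos rfl, add_zero, zero_add, mul_pow,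
      Real.sq_sqrt (Nat.cast_nonneg N)]
    ring
  · intro e _ he
    rw [if_neg he.1, if_neg he.2, add_zero]
    simp
  · simp
  · simp

/-- **`Γ(P, P) ≤ 8N`** for the reduced plaquette on `SU(N)^d`. -/
theorem Gam_ekPlaq_le (hN : N ≠ 0) {μ ν : Fin d} (hμν : μ ≠ ν) (g : PSU (Fin d) N) :
    Gam (ekPlaq μ ν) (ekPlaq μ ν) (emb g) ≤ 8 * N :=
  (Gam_le_of_linkLipschitz hN (contDiff_ekPlaq μ ν) (fun e => by positivity) (linkLipschitz_ekPlaq hμν) g).trans_eq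
    (sum_sq_lipPlaq hμν)

/-! ## Lipschitz constant of the potential and the size of the interaction term -/

/-- **The potential `-N² b S_R` is `2dN√N|b|`-Lipschitz in every link**: each link enters at most
`2d` ordered reduced plaquettes, each with weight `N|b|/2` and Lipschitz constant `2√N`. -/
theorem linkLipschitz_ekPot (hN : N ≠ 0) (b : ℝ) :
    LinkLipschitz (ekPot d N b) (fun _ => 2 * d * N * Real.sqrt N * |b|) := by
  intro e g h hgh
  have hNr : (0 : ℝ) < N := by exact_mod_cast Nat.pos_of_ne_zero hN
  set D := suFrobDist (g e) (h e) with hD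
  have hD0 : 0 ≤ D := Literature.MathematicalPhysics.QuantumFieldTheory.suFrobDist_nonneg _ _
  set a : ℝ := 2 * Real.sqrt N with ha
  have ha0 : 0 ≤ a := by positivity
  have hterm : ∀ κ l : Fin d, |ekTerm κ l (emb g) - ekTerm κ l (emb h)| ≤
      1 / (2 * (N : ℝ)) * (((if e = κ then a else 0) + (if e = l then a else 0)) * D) := by
    intro κ l
    by_cases hκl : κ = l
    · simp only [ekTerm, hκl, if_true, sub_self, abs_zero]
      positivity
    · have hP := linkLipschitz_ekPlaq (N := N) hκl e g h hgh
      simp only [ekTerm, hκl, if_false]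
      have e1 : (1 - ekPlaq κ l (emb g) / N) / 2 - (1 - ekPlaq κ l (emb h) / N) / 2 =
          -(1 / (2 * (N : ℝ))) * (ekPlaq κ l (emb g) - ekPlaq κ l (emb h)) := by
        field_simp
        ring
      rw [e1, abs_mul, abs_neg, abs_of_pos (by positivity : (0 : ℝ) < 1 / (2 * N))]
      exact mul_le_mul_of_nonneg_left hP (by positivity)
  have hsum : ∑ κ : Fin d, ∑ l : Fin d,
      1 / (2 * (N : ℝ)) * (((if e = κ then a else 0) + (if e = l then a else 0)) * D) =
        1 / (2 * (N : ℝ)) * (2 * d * a) * D := by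
    have h1 : ∀ κ : Fin d, ∑ l : Fin d, (((if e = κ then a else 0) + (if e = l then a else 0)) * D) =
        (d * (if e = κ then a else 0) + a) * D := by
      intro κ
      rw [← Finset.sum_mul, Finset.sum_add_distrib, Finset.sum_const, Finset.card_univ, Fintype.card_fin,
        Finset.sum_ite_eq, if_pos (Finset.mem_univ _), nsmul_eq_mul]
    simp_rw [← Finset.mul_sum, h1]
    rw [← Finset.sum_mul, Finset.sum_add_distrib, ← Finset.mul_sum, Finset.sum_ite_eq, if_pos (Finset.mem_univ _),
      Finset.sum_const, Finset.card_univ, Fintype.card_fin, nsmul_eq_mul]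
    ring
  have hdiff : ekPot d N b (emb g) - ekPot d N b (emb h) =
      -((N : ℝ) ^ 2 * b) * ∑ κ : Fin d, ∑ l : Fin d, (ekTerm κ l (emb g) - ekTerm κ l (emb h)) := by
    simp only [ekPot_eq, Finset.sum_sub_distrib]
    ring
  rw [hdiff, abs_mul, abs_neg, abs_mul, abs_of_nonneg (by positivity : (0 : ℝ) ≤ (N : ℝ) ^ 2)]
  calc (N : ℝ) ^ 2 * |b| * |∑ κ : Fin d, ∑ l : Fin d, (ekTerm κ l (emb g) - ekTerm κ l (emb h))|
      ≤ (N : ℝ) ^ 2 * |b| * ∑ κ : Fin d, ∑ l : Fin d,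
          1 / (2 * (N : ℝ)) * (((if e = κ then a else 0) + (if e = l then a else 0)) * D) := by
        refine mul_le_mul_of_nonneg_left ?_ (by positivity)
        refine (Finset.abs_sum_le_sum_abs _ _).trans (Finset.sum_le_sum fun κ _ => ?_)
        exact (Finset.abs_sum_le_sum_abs _ _).trans (Finset.sum_le_sum fun l _ => hterm κ l)
    _ = 2 * d * N * Real.sqrt N * |b| * D := by
        rw [hsum, ha]
        field_simp

/-- **`Γ(S, S) ≤ 4 d³ N³ b²`** for the Eguchi–Kawai potential on `SU(N)^d`. -/
theorem Gam_ekPot_le (hN : N ≠ 0) (b : ℝ) (g : PSU (Fin d) N) :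
    Gam (ekPot d N b) (ekPot d N b) (emb g) ≤ (2 * d * N * Real.sqrt N * |b|) ^ 2 * d := by
  refine (Gam_le_of_linkLipschitz hN (contDiff_ekPot b) (fun _ => by positivity) (linkLipschitz_ekPot hN b) g).trans_eq ?_
  rw [Finset.sum_const, Finset.card_univ, Fintype.card_fin, nsmul_eq_mul, mul_comm]

/-- **The interaction term of the loop equation is `O(N² b)`**:
`|Γ(-N² b S_R, Re tr P_{μν})| ≤ 6 d² N² |b|` pointwise on `SU(N)^d`. -/
theorem abs_Gam_ekPot_ekPlaq_le (hN : N ≠ 0) {μ ν : Fin d} (hμν : μ ≠ ν) (b : ℝ) (g : PSU (Fin d) N) :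
    |Gam (ekPot d N b) (ekPlaq μ ν) (emb g)| ≤ 6 * (d : ℝ) ^ 2 * N ^ 2 * |b| := by
  have hNr : (0 : ℝ) < N := by exact_mod_cast Nat.pos_of_ne_zero hN
  have hd : (0 : ℝ) ≤ d := Nat.cast_nonneg d
  have h := abs_Gam_le (ekPot d N b) (ekPlaq μ ν) (emb g)
  -- `√Γ(S,S) ≤ 2 d² N √N |b|`
  have hS : Real.sqrt (Gam (ekPot d N b) (ekPot d N b) (emb g)) ≤ 2 * (d : ℝ) ^ 2 * N * Real.sqrt N * |b| := by
    have hdd : (d : ℝ) ≤ (d : ℝ) ^ 2 := by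
      rcases Nat.eq_zero_or_pos d with h0 | h0
      · simp [h0]
      · have : (1 : ℝ) ≤ d := by exact_mod_cast h0
        nlinarith
    have hle : Gam (ekPot d N b) (ekPot d N b) (emb g) ≤ (2 * (d : ℝ) ^ 2 * N * Real.sqrt N * |b|) ^ 2 := by
      refine (Gam_ekPot_le hN b g).trans ?_
      have hx : 0 ≤ (2 * (d : ℝ) * N * Real.sqrt N * |b|) ^ 2 := sq_nonneg _
      calc (2 * (d : ℝ) * N * Real.sqrt N * |b|) ^ 2 * d
          ≤ (2 * (d : ℝ) * N * Real.sqrt N * |b|) ^ 2 * (d : ℝ) ^ 2 := mul_le_mul_of_nonneg_left hdd hx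
        _ = (2 * (d : ℝ) ^ 2 * N * Real.sqrt N * |b|) ^ 2 := by ring
    calc Real.sqrt (Gam (ekPot d N b) (ekPot d N b) (emb g))
        ≤ Real.sqrt ((2 * (d : ℝ) ^ 2 * N * Real.sqrt N * |b|) ^ 2) := Real.sqrt_le_sqrt hle
      _ = 2 * (d : ℝ) ^ 2 * N * Real.sqrt N * |b| := Real.sqrt_sq (by positivity)
  -- `√Γ(P,P) ≤ 3 √N`
  have hP : Real.sqrt (Gam (ekPlaq μ ν) (ekPlaq μ ν) (emb g)) ≤ 3 * Real.sqrt N := by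
    have hle : Gam (ekPlaq μ ν) (ekPlaq μ ν) (emb g) ≤ (3 * Real.sqrt N) ^ 2 := by
      refine (Gam_ekPlaq_le hN hμν g).trans ?_
      rw [mul_pow, Real.sq_sqrt hNr.le]
      linarith
    calc Real.sqrt (Gam (ekPlaq μ ν) (ekPlaq μ ν) (emb g))
        ≤ Real.sqrt ((3 * Real.sqrt N) ^ 2) := Real.sqrt_le_sqrt hle
      _ = 3 * Real.sqrt N := Real.sqrt_sq (by positivity)
  calc |Gam (ekPot d N b) (ekPlaq μ ν) (emb g)|
      ≤ Real.sqrt (Gam (ekPot d N b) (ekPot d N b) (emb g)) * Real.sqrt (Gam (ekPlaq μ ν) (ekPlaq μ ν) (emb g)) := h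
    _ ≤ (2 * (d : ℝ) ^ 2 * N * Real.sqrt N * |b|) * (3 * Real.sqrt N) :=
        mul_le_mul hS hP (Real.sqrt_nonneg _) (by positivity)
    _ = 6 * (d : ℝ) ^ 2 * N ^ 2 * |b| := by
        have : Real.sqrt N * Real.sqrt N = N := Real.mul_self_sqrt hNr.le
        calc (2 * (d : ℝ) ^ 2 * N * Real.sqrt N * |b|) * (3 * Real.sqrt N)
            = 6 * (d : ℝ) ^ 2 * N * (Real.sqrt N * Real.sqrt N) * |b| := by ring
          _ = 6 * (d : ℝ) ^ 2 * N ^ 2 * |b| := by rw [this]; ring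

/-! ## The reduced plaquette at strong coupling -/

/-- The open-line order parameter controls `∫ w |tr V_μ|²`: `∫ w |tr V_μ|² = N² · ⟨|(1/N) tr V_μ|²⟩ · Z`. -/
theorem integral_ekWeight_mul_norm_trace_sq (hN : N ≠ 0) (b : ℝ) (μ : Fin d) :
    ∫ V : EKConfigSU d N, ekWeight N b (inclSU V) * ‖(V μ : Matrix (Fin N) (Fin N) ℂ).trace‖ ^ 2 ∂(ekHaarSU d N) =
      (N : ℝ) ^ 2 * (ekOrderParameterSU d N b μ * ∫ V : EKConfigSU d N, ekWeight N b (inclSU V) ∂(ekHaarSU d N)) := by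
  have hZ := ekPartitionSU_pos d N b
  have hNr : (0 : ℝ) < N := by exact_mod_cast Nat.pos_of_ne_zero hN
  unfold ekOrderParameterSU ekExpectationSU
  rw [div_mul_cancel₀ _ hZ.ne', ← integral_const_mul]
  refine integral_congr_ae (ae_of_all _ fun V => ?_)
  simp only [openLine, coe_inclSU_apply, norm_div, Complex.norm_natCast, div_pow]
  field_simp

/-- The normalised plaquette expectation and the un-normalised numerator:
`∫ w Re tr P = N · ⟨(1/N) Re tr P⟩ · Z`. -/
theorem integral_ekWeight_mul_rePlaq (hN : N ≠ 0) (b : ℝ) (μ ν : Fin d) :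
    ∫ V : EKConfigSU d N, ekWeight N b (inclSU V) * (ekPlaqTrace (inclSU V) μ ν).re ∂(ekHaarSU d N) =
      (N : ℝ) * (ekExpectationSU N b (fun V : EKConfigSU d N => (ekPlaqTrace (inclSU V) μ ν).re / N) *
        ∫ V : EKConfigSU d N, ekWeight N b (inclSU V) ∂(ekHaarSU d N)) := by
  have hZ := ekPartitionSU_pos d N b
  have hNr : (0 : ℝ) < N := by exact_mod_cast Nat.pos_of_ne_zero hN
  unfold ekExpectationSU
  rw [div_mul_cancel₀ _ hZ.ne', ← integral_const_mul]
  refine integral_congr_ae (ae_of_all _ fun V => ?_)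
  simp only
  field_simp

/-- **The reduced plaquette of the Eguchi–Kawai model is `O(b) + O(1/N²)` at strong coupling,
uniformly in `N`.** For `N ≥ 2`, `μ ≠ ν` and `8|b|(d-1) < 1`:
`|⟨(1/N) Re tr(V_νᴴ V_μᴴ V_ν V_μ)⟩_{SU(N) EK}| ≤ 4 / (N² (1 - 8|b|(d-1))) + (3/2) d² |b|`
— the loop equation `ek_plaquette_loopEquation`, the open-line bound
`ekOrderParameter_le_of_strongCoupling` (unbroken centre symmetry at strong coupling) for the split
terms, and `abs_Gam_ekPot_ekPlaq_le` for the interaction term. -/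
theorem ek_plaquette_abs_le (hN : 2 ≤ N) {μ ν : Fin d} (hμν : μ ≠ ν) {b : ℝ}
    (hb : 8 * |b| * ((d : ℝ) - 1) < 1) :
    |ekExpectationSU N b (fun V : EKConfigSU d N => (ekPlaqTrace (inclSU V) μ ν).re / N)| ≤
      4 / ((N : ℝ) ^ 2 * (1 - 8 * |b| * ((d : ℝ) - 1))) + 3 / 2 * (d : ℝ) ^ 2 * |b| := by
  have hN0 : N ≠ 0 := by omega
  have hNr : (0 : ℝ) < N := by exact_mod_cast Nat.pos_of_ne_zero hN0
  have hZ := ekPartitionSU_pos d N b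
  -- the loop equation in normalised quantities
  have hloop := ek_plaquette_loopEquation hN0 hμν b
  rw [integral_ekWeight_mul_rePlaq hN0 b μ ν, integral_ekWeight_mul_norm_trace_sq hN0 b μ,
    integral_ekWeight_mul_norm_trace_sq hN0 b ν] at hloop
  set Z := ∫ V : EKConfigSU d N, ekWeight N b (inclSU V) ∂(ekHaarSU d N) with hZdef
  set E := ekExpectationSU N b (fun V : EKConfigSU d N => (ekPlaqTrace (inclSU V) μ ν).re / N) with hEdef
  set G := ∫ V : EKConfigSU d N, ekWeight N b (inclSU V) * Gam (ekPot d N b) (ekPlaq μ ν) (emb V) ∂(ekHaarSU d N)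
    with hGdef
  -- size of the interaction term
  have hG : |G| ≤ 6 * (d : ℝ) ^ 2 * N ^ 2 * |b| * Z := by
    haveI : IsProbabilityMeasure (ekHaarSU d N) := by
      rw [← haarPi_eq_ekHaarSU]; infer_instance
    have hw : Continuous fun V : PSU (Fin d) N => ekWeight N b (inclSU V) := by
      have := continuous_restrict ((contDiff_ekPot (d := d) (N := N) b).exp)
      simpa only [exp_ekPot_emb] using this
    have hΓ : Continuous fun V : PSU (Fin d) N => Gam (ekPot d N b) (ekPlaq μ ν) (emb V) :=
      continuous_restrict (contDiff_Gam (contDiff_ekPot b) (contDiff_ekPlaq μ ν))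
    calc |G| ≤ ∫ V : EKConfigSU d N, |ekWeight N b (inclSU V) * Gam (ekPot d N b) (ekPlaq μ ν) (emb V)| ∂(ekHaarSU d N) :=
          abs_integral_le_integral_abs
      _ ≤ ∫ V : EKConfigSU d N, 6 * (d : ℝ) ^ 2 * N ^ 2 * |b| * ekWeight N b (inclSU V) ∂(ekHaarSU d N) := by
          refine integral_mono (integrable_of_continuous_PSU (hw.mul hΓ).abs _)
            ((integrable_of_continuous_PSU hw _).const_mul _) fun V => ?_
          have hwpos : 0 < ekWeight N b (inclSU V) := Real.exp_pos _
          rw [abs_mul, abs_of_pos hwpos, mul_comm (6 * (d : ℝ) ^ 2 * N ^ 2 * |b|)]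
          exact mul_le_mul_of_nonneg_left (abs_Gam_ekPot_ekPlaq_le hN0 hμν b V) hwpos.le
      _ = 6 * (d : ℝ) ^ 2 * N ^ 2 * |b| * Z := integral_const_mul _ _
  -- the open lines at strong coupling
  have hOμ : ekOrderParameterSU d N b μ ≤ 4 / ((N : ℝ) ^ 2 * (1 - 8 * |b| * ((d : ℝ) - 1))) := by
    rw [ekOrderParameterSU_eq]; exact ekOrderParameter_le_of_strongCoupling hN hb μ
  have hOν : ekOrderParameterSU d N b ν ≤ 4 / ((N : ℝ) ^ 2 * (1 - 8 * |b| * ((d : ℝ) - 1))) := by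
    rw [ekOrderParameterSU_eq]; exact ekOrderParameter_le_of_strongCoupling hN hb ν
  -- solve the loop equation for `E`
  have hE : E = (ekOrderParameterSU d N b μ + ekOrderParameterSU d N b ν) / 2 + G / (4 * (N : ℝ) ^ 2 * Z) := by
    have h4 : (4 : ℝ) * (N : ℝ) ^ 2 * Z ≠ 0 := by positivity
    have key : 4 * (N : ℝ) ^ 2 * Z * E =
        4 * (N : ℝ) ^ 2 * Z * ((ekOrderParameterSU d N b μ + ekOrderParameterSU d N b ν) / 2 + G / (4 * (N : ℝ) ^ 2 * Z)) := by
      rw [mul_add, mul_div_cancel₀ _ h4]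
      linear_combination hloop
    exact mul_left_cancel₀ h4 key
  rw [hE]
  have hGZ : |G / (4 * (N : ℝ) ^ 2 * Z)| ≤ 3 / 2 * (d : ℝ) ^ 2 * |b| := by
    rw [abs_div, abs_of_pos (by positivity : (0 : ℝ) < 4 * (N : ℝ) ^ 2 * Z), div_le_iff₀ (by positivity)]
    calc |G| ≤ 6 * (d : ℝ) ^ 2 * N ^ 2 * |b| * Z := hG
      _ = 3 / 2 * (d : ℝ) ^ 2 * |b| * (4 * (N : ℝ) ^ 2 * Z) := by ring
  calc |(ekOrderParameterSU d N b μ + ekOrderParameterSU d N b ν) / 2 + G / (4 * (N : ℝ) ^ 2 * Z)|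
      ≤ |(ekOrderParameterSU d N b μ + ekOrderParameterSU d N b ν) / 2| + |G / (4 * (N : ℝ) ^ 2 * Z)| :=
        abs_add_le _ _
    _ ≤ 4 / ((N : ℝ) ^ 2 * (1 - 8 * |b| * ((d : ℝ) - 1))) + 3 / 2 * (d : ℝ) ^ 2 * |b| := by
        have h0μ := Literature.Barriers.QuantumFields.ekOrderParameterSU_nonneg d N b μ
        have h0ν := Literature.Barriers.QuantumFields.ekOrderParameterSU_nonneg d N b ν
        rw [abs_of_nonneg (by positivity)]
        linarith

end Summit.QuantumFields.YangMills.Theorems.EguchiKawaiDirectionLadder
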